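import Literature.NumberTheory.Transcendental.KZCubicalCalculus
import Mathlib.Topology.Algebra.Polynomial
import Mathlib.Topology.UniformSpace.HeineCantor
import Mathlib.Analysis.SpecialFunctions.Trigonometric.ArctanDeriv
import Mathlib.Analysis.SpecificLimits.Basic

/-!
# `StokesGeneration` (stmt-KontsevichZagierPeriods-3586) — line `fibrewise_stokes`, stub `stub_rungPartition`

Registered rung stub R14 (rung 4) of the line `fibrewise_stokes` of the crux `StokesGeneration`
(route UnfoldedStokes): **the grid partition of a root-free polynomial loop**.

Let `P = A + iB` (`A`, `B` real polynomials) have no zero on `[0,1]`, i.e. `A² + B² ≠ 0` there,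
and let `M ≥ 0`. Then there is a mesh `N ≥ 1` such that on every piece `[k/N, (k+1)/N]`
(`k < N`) the re-centred real part `Re (P(u) · conj P(k/N)) = A(u) A(k/N) + B(u) B(k/N)` is
positive, and moreover `M/N < π/2` and `M · tan² (M/N) < π/2`.

Proof. `F(u,v) = A(u) A(v) + B(u) B(v)` is continuous on the compact square `[0,1]²`, hence
uniformly continuous (Heine–Cantor), and `F(v,v) = A(v)² + B(v)² ≥ m > 0` where `m` is the
minimum of `A² + B²` on `[0,1]` (extreme value theorem). With `δ` the uniform-continuity modulus
for `ε = m`, every `N` with `1/N < δ` works: for `u ∈ [k/N, (k+1)/N]`, `k < N`, both `u` and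
`v = k/N` lie in `[0,1]` and `|u − v| ≤ 1/N < δ`, so `F(u,v) > F(v,v) − m ≥ 0`. The two smallness
conditions hold for all large `N` since `M/N → 0` and `x ↦ M tan² x` is continuous at `0` with
value `0 < π/2`. All four conditions hold eventually along `atTop`, so a common `N` exists.
[folklore]

References: M. Kontsevich, D. Zagier, *Periods* (2001), §1.2 (context only; the statement is
elementary real analysis).
-/

noncomputable section

-- `Summit.KontsevichZagierPeriods.KontsevichZagierPeriods.…` is the tree's mandated layout (single-conjunct summit).
set_option linter.dupNamespace false

namespace Summit.KontsevichZagierPeriods.KontsevichZagierPeriods.Cruxes.StokesGeneration.FibrewiseStokes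

open MeasureTheory Set
open Literature.NumberTheory.Transcendental
open Literature.NumberTheory.Transcendental.KZ
open Literature.ModelTheory.ExponentialFields (IsSemialgebraic)

/-! ## Grid bookkeeping -/

/-- For `1 ≤ N`, `k < N` and `u ∈ [k/N, (k+1)/N]`: both `u` and `k/N` lie in `[0,1]` and
`dist u (k/N) ≤ 1/N`. [folklore] -/
theorem rungPartition_grid_mem {N k : ℕ} (hN : 1 ≤ N) (hk : k < N) {u : ℝ}
    (hu : u ∈ Set.Icc ((k : ℝ) / N) (((k : ℝ) + 1) / N)) :
    u ∈ Set.Icc (0:ℝ) 1 ∧ (k : ℝ) / N ∈ Set.Icc (0:ℝ) 1 ∧ dist u ((k : ℝ) / N) ≤ 1 / N := by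
  have hNpos : (0:ℝ) < N := Nat.cast_pos.mpr (by omega)
  have hk' : (k:ℝ) + 1 ≤ N := by exact_mod_cast Nat.succ_le_of_lt hk
  have hv0 : 0 ≤ (k : ℝ) / N := by positivity
  have hv1 : (k : ℝ) / N ≤ 1 := by
    rw [div_le_one hNpos]
    linarith
  have hu2 : u ≤ (k : ℝ) / N + 1 / N := by
    have h := hu.2
    rwa [add_div] at h
  have hu1 : u ≤ 1 := by
    refine le_trans hu.2 ?_
    rw [div_le_one hNpos]
    exact hk'
  refine ⟨⟨le_trans hv0 hu.1, hu1⟩, ⟨hv0, hv1⟩, ?_⟩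
  rw [Real.dist_eq, abs_of_nonneg (by linarith [hu.1])]
  linarith

/-! ## Positivity of the re-centred real part on a fine grid -/

/-- If `A² + B² ≠ 0` on `[0,1]`, then for all sufficiently large `N`, on every grid piece
`[k/N, (k+1)/N]` (`k < N`) one has `A(u) A(k/N) + B(u) B(k/N) > 0` (uniform continuity of
`(u,v) ↦ A(u) A(v) + B(u) B(v)` on `[0,1]²` and the positive minimum of `A² + B²`). [folklore] -/
theorem rungPartition_eventually_pos (A B : Polynomial ℝ)
    (hAB : ∀ u ∈ Set.Icc (0:ℝ) 1, A.eval u ^ 2 + B.eval u ^ 2 ≠ 0) :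
    ∀ᶠ N : ℕ in Filter.atTop, ∀ k : ℕ, k < N →
      ∀ u ∈ Set.Icc ((k : ℝ) / N) (((k : ℝ) + 1) / N),
        0 < A.eval u * A.eval ((k : ℝ) / N) + B.eval u * B.eval ((k : ℝ) / N) := by
  -- the positive minimum `m` of `A² + B²` on `[0,1]`
  have hEc : Continuous fun u : ℝ => A.eval u ^ 2 + B.eval u ^ 2 := by fun_prop
  obtain ⟨x₀, hx₀, hmin⟩ := isCompact_Icc.exists_isMinOn (Set.nonempty_Icc.2 (zero_le_one' ℝ))
    hEc.continuousOn
  set m : ℝ := A.eval x₀ ^ 2 + B.eval x₀ ^ 2 with hm_def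
  have hm : 0 < m := lt_of_le_of_ne (by positivity) (hAB x₀ hx₀).symm
  -- uniform continuity of `F (u, v) = A u * A v + B u * B v` on the compact square
  have hK : IsCompact (Set.Icc (0:ℝ) 1 ×ˢ Set.Icc (0:ℝ) 1) := isCompact_Icc.prod isCompact_Icc
  have hFc : Continuous fun p : ℝ × ℝ => A.eval p.1 * A.eval p.2 + B.eval p.1 * B.eval p.2 := by
    fun_prop
  have hUC := hK.uniformContinuousOn_of_continuous hFc.continuousOn
  rw [Metric.uniformContinuousOn_iff] at hUC
  obtain ⟨δ, hδ, hδF⟩ := hUC m hm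
  have hev : ∀ᶠ N : ℕ in Filter.atTop, (1:ℝ) / N < δ :=
    (tendsto_const_div_atTop_nhds_zero_nat (1:ℝ)).eventually_lt_const hδ
  filter_upwards [hev, Filter.eventually_ge_atTop 1] with N hNδ hN1
  intro k hk u hu
  obtain ⟨hu01, hv01, hdist⟩ := rungPartition_grid_mem hN1 hk hu
  set v : ℝ := (k : ℝ) / N with hv_def
  have hmem1 : (u, v) ∈ Set.Icc (0:ℝ) 1 ×ˢ Set.Icc (0:ℝ) 1 := ⟨hu01, hv01⟩
  have hmem2 : (v, v) ∈ Set.Icc (0:ℝ) 1 ×ˢ Set.Icc (0:ℝ) 1 := ⟨hv01, hv01⟩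
  have hd : dist (u, v) (v, v) < δ := by
    rw [Prod.dist_eq, dist_self, max_eq_left dist_nonneg]
    exact lt_of_le_of_lt hdist hNδ
  have key := hδF (u, v) hmem1 (v, v) hmem2 hd
  rw [Real.dist_eq] at key
  have hlow := (abs_lt.1 key).1
  have hminv : m ≤ A.eval v ^ 2 + B.eval v ^ 2 := (isMinOn_iff.1 hmin) v hv01
  have hsq : A.eval v ^ 2 + B.eval v ^ 2 = A.eval v * A.eval v + B.eval v * B.eval v := by ring
  simp only at hlow
  linarith

/-! ## The two smallness conditions -/

/-- For `M` real, eventually in `N`: `M/N < π/2`. [folklore] -/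
theorem rungPartition_eventually_div_lt (M : ℝ) :
    ∀ᶠ N : ℕ in Filter.atTop, M / (N : ℝ) < Real.pi / 2 :=
  (tendsto_const_div_atTop_nhds_zero_nat M).eventually_lt_const (by positivity)

/-- For `M` real, eventually in `N`: `M · tan² (M/N) < π/2` (continuity of `tan` at `0`).
[folklore] -/
theorem rungPartition_eventually_tan_lt (M : ℝ) :
    ∀ᶠ N : ℕ in Filter.atTop, M * Real.tan (M / N) ^ 2 < Real.pi / 2 := by
  have htan : ContinuousAt Real.tan 0 :=
    Real.continuousAt_tan.2 (by rw [Real.cos_zero]; exact one_ne_zero)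
  have hc : ContinuousAt (fun x : ℝ => M * Real.tan x ^ 2) 0 :=
    continuousAt_const.mul (htan.pow 2)
  have ht := hc.tendsto.comp (tendsto_const_div_atTop_nhds_zero_nat M)
  rw [Real.tan_zero, zero_pow two_ne_zero, mul_zero] at ht
  exact ht.eventually_lt_const (by positivity)

/-! ## The registered stub -/

/-- **Registered stub `stub_rungPartition` (R14, rung 4 of the line `fibrewise_stokes`).**
For real polynomials `A`, `B` with `A² + B² ≠ 0` on `[0,1]` and `M ≥ 0` there is a mesh `N ≥ 1`
such that `A(u) A(k/N) + B(u) B(k/N) > 0` for `u ∈ [k/N, (k+1)/N]`, `k < N` (the loop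
`P = A + iB` re-centred at the grid point stays in the right half-plane on each piece), and
`M/N < π/2`, `M · tan² (M/N) < π/2`. Heine–Cantor on `[0,1]²` plus the extreme value theorem,
and `M/N → 0`. [folklore] -/
theorem stub_rungPartition :
    ∀ (A B : Polynomial ℝ) (M : ℝ), (∀ u ∈ Set.Icc (0:ℝ) 1, A.eval u ^ 2 + B.eval u ^ 2 ≠ 0) → 0 ≤ M →
      ∃ N : ℕ, 1 ≤ N ∧
        (∀ k : ℕ, k < N → ∀ u ∈ Set.Icc ((k : ℝ) / N) (((k : ℝ) + 1) / N),
          0 < A.eval u * A.eval ((k : ℝ) / N) + B.eval u * B.eval ((k : ℝ) / N)) ∧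
        M / N < Real.pi / 2 ∧ M * Real.tan (M / N) ^ 2 < Real.pi / 2 := by
  intro A B M hAB _hM
  obtain ⟨N, hN1, hN, hN2, hN3⟩ := ((Filter.eventually_ge_atTop 1).and
    ((rungPartition_eventually_pos A B hAB).and
      ((rungPartition_eventually_div_lt M).and (rungPartition_eventually_tan_lt M)))).exists
  exact ⟨N, hN1, hN, hN2, hN3⟩

end Summit.KontsevichZagierPeriods.KontsevichZagierPeriods.Cruxes.StokesGeneration.FibrewiseStokes
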